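import Mathlib
import Literature.NumberTheory.Transcendental.KZCalculusProofs
import Literature.NumberTheory.Transcendental.KZCubicalCalculus
import Literature.NumberTheory.Transcendental.KZLogCalculusProofs
import Literature.NumberTheory.Transcendental.KZSemiCanonicalReductionProofs
import Literature.NumberTheory.Transcendental.KZVolumeConjectureProofs

/-!
# OffTetraSectorKernel (stmt-KontsevichZagierPeriods-10557), line odd-hyperbolic-ladder: stub stub_valueOneOfOrbit

CUBE ORBIT ⇒ VALUE ONE, one dimension down (oracle-generic). Let `W` be any subgroup of the formal
group `KZ.FormalRep`. If every compact top-dimensional integrand-`1` solid `K ⊂ ℝ^{d+1}` of volume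
`1` reaches the unit cube `[0,1]^{d+1}` (integrand `1`) modulo `relations ⊔ W`, then every
representation `G` of dimension `d` and value `1` reaches `[0,1]^d` modulo `relations ⊔ W`.

Proof. The discharged, resolution-free Viu-Sos reduction
(`KZ.exists_isCompact_sub_mem_relations_of_value_pos`) turns `G` (value `1 > 0`) into ONE compact
top-dimensional integrand-`1` solid `K ⊂ ℝ^{d+1}` with `[G] ≡ [K]` modulo relations, hence of value
`1` (soundness `KZ.Equivalent.value_eq_holds`); the orbit hypothesis sends `K` to the
`(d+1)`-cube `Q'`; and `Q'` agrees as a representation (same domain by `KZ.cube_succ_eq`, same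
integrand `1` on it) with the slab `Q.slab 0` of the `d`-cube `Q`, which is one Newton–Leibniz move
above `Q` (`KZ.IntegralRep.equivalent_slab`). The bookkeeping closes in the free abelian group.
-/

noncomputable section

open Set MeasureTheory
open Literature.NumberTheory.Transcendental

namespace Summit.KontsevichZagierPeriods.HyperbolicBloch.OffTetraSectorKernel

/-- The unit cube `[0,1]^n` carries an integral representation with integrand `1`
(`KZ.exists_oneRep` on the `ℚ`-semialgebraic finite-volume set `KZ.cube n`). [folklore] -/
theorem voo_exists_cubeRep (n : ℕ) :
    ∃ Q : KZ.IntegralRep n, Q.domain = KZ.cube n ∧ Q.integrand = fun _ => 1 :=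
  KZ.exists_oneRep (KZ.isSemialgebraic_cube (n := n)) (by simp)

/-- The cube `[0,1]^{d+1}` with integrand `1` and the slab of height one at level `0` over the cube
`[0,1]^d` with integrand `1` are the same representation up to a relation: the domains coincide
(`KZ.cube_succ_eq`) and both integrands are `1` there (congruence
`KZ.of_sub_of_mem_relations_of_eqOn`). [folklore] -/
theorem voo_of_cube_sub_of_slab_mem_relations {d : ℕ} {Q' : KZ.IntegralRep (d + 1)}
    {Q : KZ.IntegralRep d} (hQ'd : Q'.domain = KZ.cube (d + 1))
    (hQ'i : Q'.integrand = fun _ => 1) (hQ : Q.domain = KZ.cube d)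
    (hQ1 : ∀ x ∈ Q.domain, Q.integrand x = 1) :
    KZ.of Q' - KZ.of (Q.slab 0) ∈ KZ.relations := by
  refine KZ.of_sub_of_mem_relations_of_eqOn ?_ fun z hz => ?_
  · rw [KZ.IntegralRep.domain_slab, hQ'd, KZ.cube_succ_eq]
    ext z
    simp only [KZ.IntegralRep.slabDomain, hQ, mem_setOf_eq, Nat.cast_zero, zero_add]
  · rw [hQ'd, KZ.cube_succ_eq] at hz
    rw [hQ'i, KZ.IntegralRep.integrand_slab]
    exact (hQ1 _ (hQ ▸ hz.1)).symm

/-- STUB `stub_valueOneOfOrbit` (CUBE ORBIT ⇒ VALUE ONE, one dimension down): if every compact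
top-dimensional integrand-`1` solid of `ℝ^{d+1}` of volume `1` reaches `[0,1]^{d+1}` modulo
`relations ⊔ W`, then every representation of dimension `d` and value `1` reaches `[0,1]^d` modulo
`relations ⊔ W`. [cite: ViuSos2021, Thm. 1.1] -/
theorem stub_valueOneOfOrbit (W : AddSubgroup KZ.FormalRep) (d : ℕ)
    (horbit : ∀ (K Q : KZ.IntegralRep (d + 1)), IsCompact K.domain → (interior K.domain).Nonempty →
      (∀ x ∈ K.domain, K.integrand x = 1) → Q.domain = KZ.cube (d + 1) →
      (∀ x ∈ Q.domain, Q.integrand x = 1) → K.value = 1 → KZ.of K - KZ.of Q ∈ KZ.relations ⊔ W)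
    (G Q : KZ.IntegralRep d) (hQ : Q.domain = KZ.cube d) (hQ1 : ∀ x ∈ Q.domain, Q.integrand x = 1)
    (hGv : G.value = 1) : KZ.of G - KZ.of Q ∈ KZ.relations ⊔ W := by
  -- Viu-Sos: `[G] ≡ [K]` with `K ⊂ ℝ^{d+1}` compact, top-dimensional, integrand `1`
  obtain ⟨K, hKc, hKi, hK1, hGK⟩ :=
    KZ.exists_isCompact_sub_mem_relations_of_value_pos G (by rw [hGv]; exact one_pos)
  -- soundness of the moves: `K` has value `1`
  have hKv : K.value = 1 := (KZ.Equivalent.value_eq_holds hGK).symm.trans hGv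
  -- the cube of dimension `d + 1`
  obtain ⟨Q', hQ'd, hQ'i⟩ := voo_exists_cubeRep (d + 1)
  -- the orbit hypothesis sends `K` to the `(d+1)`-cube
  have h1 : KZ.of K - KZ.of Q' ∈ KZ.relations ⊔ W :=
    horbit K Q' hKc hKi hK1 hQ'd (fun x _ => by simp [hQ'i]) hKv
  -- the `(d+1)`-cube is the slab over the `d`-cube, one Newton–Leibniz move above it
  have h2 : KZ.of Q' - KZ.of (Q.slab 0) ∈ KZ.relations :=
    voo_of_cube_sub_of_slab_mem_relations hQ'd hQ'i hQ hQ1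
  have h3 : KZ.of Q - KZ.of (Q.slab 0) ∈ KZ.relations := Q.equivalent_slab 0
  -- bookkeeping in the free abelian group
  have key : KZ.of G - KZ.of Q = (KZ.of G - KZ.of K) + (KZ.of K - KZ.of Q')
      + (KZ.of Q' - KZ.of (Q.slab 0)) - (KZ.of Q - KZ.of (Q.slab 0)) := by
    abel
  rw [key]
  exact sub_mem (add_mem (add_mem (AddSubgroup.mem_sup_left hGK) h1)
    (AddSubgroup.mem_sup_left h2)) (AddSubgroup.mem_sup_left h3)

end Summit.KontsevichZagierPeriods.HyperbolicBloch.OffTetraSectorKernel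

end
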